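import Mathlib
import HarnessLib
import Literature.Analysis.FluidPDE.Tao2016AveragedNS.TaylorChainCertificate

/-!
# Line `taylor-model` on crux K1b-DR (stmt-NavierStokesRegularity-23954) — stub G1 (`ChainEnclosureHolds`),
# helper 3: monotonicity in time of the three Cauchy majorants `Rem`, `RemV`, `Dev`

The certificate states its in-step spread inequalities at the END of each sub-step (`u = h`); the in-step
enclosure for `u ∈ [0, h]` therefore needs the majorants to be nondecreasing in `u` under the convergence
guards. For `0 ≤ b, m, r`, `0 ≤ u₁ ≤ u₂` and the guard at `u₂`:

* `Rem_mono` — `Rem b m u = m (bmu)^(p+1)/(1 − bmu)` (product of nondecreasing nonnegative factors);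
* `RemV_eq`, `RemV_nonneg`, `RemV_mono` — `RemV b m u = q^(p+1)/(1−q)² + (p+1) q^(p+1)/(1−q)`, `q = bmu`;
* `Dev_mono` — `Dev b m r u = (m+r)/(1−b(m+r)u) − m/(1−bmu) − r/(1−bmu)²`: with `aᵢ = 1 − bmuᵢ`,
  `cᵢ = aᵢ − bruᵢ`, `Dev u₂ − Dev u₁ = b(u₂−u₁)[(m+r)²/(c₁c₂) − m²/(a₁a₂) − rm(a₁+a₂)/(a₁²a₂²)]`,
  `1/cᵢ ≥ (aᵢ + bruᵢ)/aᵢ²`, and the remaining polynomial is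
  `r²[(1 − q₁q₂) + q₁(1−q₂) + q₂(1−q₁) + br(u₁+u₂) + b²r²u₁u₂] ≥ 0`, `qᵢ = bmuᵢ ≤ 1`.

MODEL-lattice bookkeeping only (rung TL-M3); nothing here is a statement about the Navier–Stokes equations.
-/

noncomputable section

-- the sub-problem namespace repeats the summit name by design (D-0017)
set_option linter.dupNamespace false

namespace Summit.NavierStokesRegularity.NavierStokesRegularity.Theorems.TaylorModelReadout

open Literature.Analysis.FluidPDE.TaoCascade Literature.Analysis.FluidPDE.TaoCascade.TaylorChain

variable (cd : CertData)

/-- `Rem` is nondecreasing in the time argument on `[0, u₂]` under the guard `b m u₂ < 1`. [folklore] -/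
theorem Rem_mono {b m u₁ u₂ : ℝ} (hb : 0 ≤ b) (hm : 0 ≤ m) (hu₁ : 0 ≤ u₁) (hu : u₁ ≤ u₂) (hg : b * m * u₂ < 1) :
    cd.Rem b m u₁ ≤ cd.Rem b m u₂ := by
  unfold CertData.Rem
  have hq1 : 0 ≤ b * m * u₁ := by positivity
  have hq : b * m * u₁ ≤ b * m * u₂ := mul_le_mul_of_nonneg_left hu (mul_nonneg hb hm)
  have hd2 : 0 < 1 - b * m * u₂ := by linarith
  have hd1 : 0 < 1 - b * m * u₁ := by linarith
  rw [mul_div_assoc, mul_div_assoc]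
  refine mul_le_mul_of_nonneg_left ?_ hm
  exact div_le_div₀ (pow_nonneg (hq1.trans hq) _) (pow_le_pow_left₀ hq1 hq _) hd2 (by linarith)

/-- Closed form of `RemV` as a sum of two manifestly monotone terms (for `q = bmu ≠ 1`). [folklore] -/
theorem RemV_eq {b m u : ℝ} (hq : b * m * u ≠ 1) :
    cd.RemV b m u = (b * m * u) ^ (cd.pdeg + 1) / (1 - b * m * u) ^ 2 +
      ((cd.pdeg : ℝ) + 1) * (b * m * u) ^ (cd.pdeg + 1) / (1 - b * m * u) := by
  unfold CertData.RemV
  have h1 : (1 - b * m * u) ≠ 0 := sub_ne_zero.2 (Ne.symm hq)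
  field_simp
  ring

/-- `RemV ≥ 0` under the guard. [folklore] -/
theorem RemV_nonneg {b m u : ℝ} (hb : 0 ≤ b) (hm : 0 ≤ m) (hu : 0 ≤ u) (hg : b * m * u < 1) :
    0 ≤ cd.RemV b m u := by
  rw [RemV_eq cd hg.ne]
  have hq : 0 ≤ b * m * u := by positivity
  have hd : 0 < 1 - b * m * u := by linarith
  positivity

/-- `RemV` is nondecreasing in the time argument on `[0, u₂]` under the guard `b m u₂ < 1`. [folklore] -/
theorem RemV_mono {b m u₁ u₂ : ℝ} (hb : 0 ≤ b) (hm : 0 ≤ m) (hu₁ : 0 ≤ u₁) (hu : u₁ ≤ u₂)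
    (hg : b * m * u₂ < 1) : cd.RemV b m u₁ ≤ cd.RemV b m u₂ := by
  have hq1 : 0 ≤ b * m * u₁ := by positivity
  have hq : b * m * u₁ ≤ b * m * u₂ := mul_le_mul_of_nonneg_left hu (mul_nonneg hb hm)
  have hg1 : b * m * u₁ < 1 := lt_of_le_of_lt hq hg
  have hd2 : 0 < 1 - b * m * u₂ := by linarith
  have hd1 : 0 < 1 - b * m * u₁ := by linarith
  rw [RemV_eq cd hg1.ne, RemV_eq cd hg.ne]
  have hp : 0 ≤ (cd.pdeg : ℝ) + 1 := by positivity
  have hpow : (b * m * u₁) ^ (cd.pdeg + 1) ≤ (b * m * u₂) ^ (cd.pdeg + 1) := pow_le_pow_left₀ hq1 hq _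
  have hpow0 : 0 ≤ (b * m * u₂) ^ (cd.pdeg + 1) := pow_nonneg (hq1.trans hq) _
  refine add_le_add ?_ ?_
  · exact div_le_div₀ hpow0 hpow (pow_pos hd2 2) (pow_le_pow_left₀ hd2.le (by linarith) 2)
  · rw [mul_div_assoc, mul_div_assoc]
    refine mul_le_mul_of_nonneg_left ?_ hp
    exact div_le_div₀ hpow0 hpow hd2 (by linarith)

/-- The polynomial inequality behind `Dev_mono`. [folklore] -/
theorem dev_poly_nonneg {b m r u₁ u₂ : ℝ} (hb : 0 ≤ b) (hm : 0 ≤ m) (hr : 0 ≤ r) (hu₁ : 0 ≤ u₁)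
    (hu₂ : 0 ≤ u₂) (hq₁ : b * m * u₁ ≤ 1) (hq₂ : b * m * u₂ ≤ 1) :
    0 ≤ (m + r) ^ 2 * (1 - b * m * u₁ + b * r * u₁) * (1 - b * m * u₂ + b * r * u₂) -
      m ^ 2 * (1 - b * m * u₁) * (1 - b * m * u₂) - r * m * ((1 - b * m * u₁) + (1 - b * m * u₂)) := by
  have key : (m + r) ^ 2 * (1 - b * m * u₁ + b * r * u₁) * (1 - b * m * u₂ + b * r * u₂) -
      m ^ 2 * (1 - b * m * u₁) * (1 - b * m * u₂) - r * m * ((1 - b * m * u₁) + (1 - b * m * u₂)) =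
      r ^ 2 * ((1 - (b * m * u₁) * (b * m * u₂)) + (b * m * u₁) * (1 - b * m * u₂) + b * m * u₂ +
        b * r * (u₁ + u₂) + b ^ 2 * r ^ 2 * u₁ * u₂) := by ring
  rw [key]
  have hq1 : 0 ≤ b * m * u₁ := by positivity
  have hq2 : 0 ≤ b * m * u₂ := by positivity
  have h1 : 0 ≤ 1 - (b * m * u₁) * (b * m * u₂) := by nlinarith
  have h2 : 0 ≤ (b * m * u₁) * (1 - b * m * u₂) := mul_nonneg hq1 (by linarith)
  positivity

/-- `Dev` is nondecreasing in the time argument on `[0, u₂]` under the guard `b (m + r) u₂ < 1`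
(the second-order majorant defect grows with time). [folklore] -/
theorem Dev_mono {b m r u₁ u₂ : ℝ} (hb : 0 ≤ b) (hm : 0 ≤ m) (hr : 0 ≤ r) (hu₁ : 0 ≤ u₁) (hu : u₁ ≤ u₂)
    (hg : b * (m + r) * u₂ < 1) :
    CertData.Dev b m r u₁ ≤ CertData.Dev b m r u₂ := by
  have hu₂ : 0 ≤ u₂ := hu₁.trans hu
  have hbr2 : 0 ≤ b * r * u₂ := by positivity
  have hbr1 : 0 ≤ b * r * u₁ := by positivity
  have e2 : b * (m + r) * u₂ = b * m * u₂ + b * r * u₂ := by ring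
  have e1 : b * (m + r) * u₁ = b * m * u₁ + b * r * u₁ := by ring
  have hmono : b * (m + r) * u₁ ≤ b * (m + r) * u₂ := mul_le_mul_of_nonneg_left hu (by positivity)
  -- the four denominators
  have hc2 : 0 < 1 - b * (m + r) * u₂ := by linarith
  have hc1 : 0 < 1 - b * (m + r) * u₁ := by linarith
  have ha2 : 0 < 1 - b * m * u₂ := by linarith
  have ha1 : 0 < 1 - b * m * u₁ := by linarith
  have hq₂ : b * m * u₂ ≤ 1 := by linarith
  have hq₁ : b * m * u₁ ≤ 1 := by linarith
  -- the difference as `b (u₂ - u₁)` times a bracket (denominators made atomic, then substituted back)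
  have hdiff : CertData.Dev b m r u₂ - CertData.Dev b m r u₁ =
      b * (u₂ - u₁) * ((m + r) ^ 2 / ((1 - b * (m + r) * u₁) * (1 - b * (m + r) * u₂)) -
        m ^ 2 / ((1 - b * m * u₁) * (1 - b * m * u₂)) -
        r * m * ((1 - b * m * u₁) + (1 - b * m * u₂)) / ((1 - b * m * u₁) ^ 2 * (1 - b * m * u₂) ^ 2)) := by
    obtain ⟨a₁, ha₁⟩ : ∃ a : ℝ, 1 - b * m * u₁ = a := ⟨_, rfl⟩
    obtain ⟨a₂, ha₂⟩ : ∃ a : ℝ, 1 - b * m * u₂ = a := ⟨_, rfl⟩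
    obtain ⟨c₁, hc₁⟩ : ∃ c : ℝ, 1 - b * (m + r) * u₁ = c := ⟨_, rfl⟩
    obtain ⟨c₂, hc₂⟩ : ∃ c : ℝ, 1 - b * (m + r) * u₂ = c := ⟨_, rfl⟩
    have ha1' : a₁ ≠ 0 := by rw [← ha₁]; exact ha1.ne'
    have ha2' : a₂ ≠ 0 := by rw [← ha₂]; exact ha2.ne'
    have hc1' : c₁ ≠ 0 := by rw [← hc₁]; exact hc1.ne'
    have hc2' : c₂ ≠ 0 := by rw [← hc₂]; exact hc2.ne'
    unfold CertData.Dev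
    rw [ha₁, ha₂, hc₁, hc₂]
    field_simp
    rw [← ha₁, ← ha₂, ← hc₁, ← hc₂]
    ring
  -- lower bound for `1/cᵢ`
  have hci : ∀ {a c u : ℝ}, 0 < a → 0 < c → c = a - b * r * u → (a + b * r * u) / a ^ 2 ≤ 1 / c := by
    intro a c u ha hc hcu
    rw [div_le_div_iff₀ (pow_pos ha 2) hc]
    nlinarith [sq_nonneg (b * r * u)]
  have h1 : (1 - b * m * u₁ + b * r * u₁) / (1 - b * m * u₁) ^ 2 ≤ 1 / (1 - b * (m + r) * u₁) :=
    hci ha1 hc1 (by ring)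
  have h2 : (1 - b * m * u₂ + b * r * u₂) / (1 - b * m * u₂) ^ 2 ≤ 1 / (1 - b * (m + r) * u₂) :=
    hci ha2 hc2 (by ring)
  have hA1 : 0 ≤ (1 - b * m * u₁ + b * r * u₁) / (1 - b * m * u₁) ^ 2 := by positivity
  have hA2 : 0 ≤ (1 - b * m * u₂ + b * r * u₂) / (1 - b * m * u₂) ^ 2 := by positivity
  have hprod : (1 - b * m * u₁ + b * r * u₁) / (1 - b * m * u₁) ^ 2 *
      ((1 - b * m * u₂ + b * r * u₂) / (1 - b * m * u₂) ^ 2) ≤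
      1 / (1 - b * (m + r) * u₁) * (1 / (1 - b * (m + r) * u₂)) :=
    mul_le_mul h1 h2 hA2 (le_of_lt (by positivity))
  have hlow : (m + r) ^ 2 * ((1 - b * m * u₁ + b * r * u₁) / (1 - b * m * u₁) ^ 2 *
      ((1 - b * m * u₂ + b * r * u₂) / (1 - b * m * u₂) ^ 2)) ≤
      (m + r) ^ 2 / ((1 - b * (m + r) * u₁) * (1 - b * (m + r) * u₂)) := by
    have e : (m + r) ^ 2 / ((1 - b * (m + r) * u₁) * (1 - b * (m + r) * u₂)) =
        (m + r) ^ 2 * (1 / (1 - b * (m + r) * u₁) * (1 / (1 - b * (m + r) * u₂))) := by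
      rw [one_div_mul_one_div, mul_one_div]
    rw [e]
    exact mul_le_mul_of_nonneg_left hprod (sq_nonneg _)
  have hP := dev_poly_nonneg hb hm hr hu₁ hu₂ hq₁ hq₂
  have e : (m + r) ^ 2 * ((1 - b * m * u₁ + b * r * u₁) / (1 - b * m * u₁) ^ 2 *
      ((1 - b * m * u₂ + b * r * u₂) / (1 - b * m * u₂) ^ 2)) -
      m ^ 2 / ((1 - b * m * u₁) * (1 - b * m * u₂)) -
      r * m * ((1 - b * m * u₁) + (1 - b * m * u₂)) / ((1 - b * m * u₁) ^ 2 * (1 - b * m * u₂) ^ 2) =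
      ((m + r) ^ 2 * (1 - b * m * u₁ + b * r * u₁) * (1 - b * m * u₂ + b * r * u₂) -
        m ^ 2 * (1 - b * m * u₁) * (1 - b * m * u₂) - r * m * ((1 - b * m * u₁) + (1 - b * m * u₂))) /
        ((1 - b * m * u₁) ^ 2 * (1 - b * m * u₂) ^ 2) := by
    have ha1' : 1 - b * m * u₁ ≠ 0 := ha1.ne'
    have ha2' : 1 - b * m * u₂ ≠ 0 := ha2.ne'
    field_simp
  have hnn : 0 ≤ (m + r) ^ 2 * ((1 - b * m * u₁ + b * r * u₁) / (1 - b * m * u₁) ^ 2 *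
      ((1 - b * m * u₂ + b * r * u₂) / (1 - b * m * u₂) ^ 2)) -
      m ^ 2 / ((1 - b * m * u₁) * (1 - b * m * u₂)) -
      r * m * ((1 - b * m * u₁) + (1 - b * m * u₂)) / ((1 - b * m * u₁) ^ 2 * (1 - b * m * u₂) ^ 2) := by
    rw [e]; positivity
  have hbr : 0 ≤ (m + r) ^ 2 / ((1 - b * (m + r) * u₁) * (1 - b * (m + r) * u₂)) -
      m ^ 2 / ((1 - b * m * u₁) * (1 - b * m * u₂)) -
      r * m * ((1 - b * m * u₁) + (1 - b * m * u₂)) / ((1 - b * m * u₁) ^ 2 * (1 - b * m * u₂) ^ 2) := by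
    linarith
  have : 0 ≤ CertData.Dev b m r u₂ - CertData.Dev b m r u₁ := by
    rw [hdiff]
    exact mul_nonneg (mul_nonneg hb (by linarith)) hbr
  linarith

end Summit.NavierStokesRegularity.NavierStokesRegularity.Theorems.TaylorModelReadout

end
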